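import Summits.ResolutionOfSingularities.ResolutionOfSingularities.Theorems.FrobeniusClosingSteerEtaleResidueLiftMaps
import Summits.ResolutionOfSingularities.ResolutionOfSingularities.Theorems.FrobeniusClosingSteerEtaleWindowWords
import HarnessLib

/-!
# [OURS · L0 W4.1] K3-a part 4, stage B2b: RESIDUAL RATIONALITY of two levels of the lifted window
# (chain W4.1 `FrobeniusClosingSteer`, crux stmt-ResolutionOfSingularities-16345; K3 route (R1), RULINGs 250(a)/258; interface
# `D/res-D-lib-1/K3WindowInterface.lean` 1dc250035b4b213c; `--supports … --as helper`)

HONEST FRAMING. OURS kernel (HIRONAKA-L librarian res-D-lib-1 gen 7). Abstract form of the rationality of the two lower steps of the base-changed window: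
`A₀ → A` a ring map `ι` into `A` with a MAXIMAL ideal `𝔫`, `T := A_𝔫`; if every "coefficient" `of c` (`c ∈ S`, `A = S[X]/(Q)`) is congruent modulo `𝔫` to an
element of `ι(A₀)` and so is the root, then EVERY element of `A` is (`exists_sub_mem_of_coeff`), hence every element of `T` is congruent modulo `𝔪_T` to the
image of an element of `A₀` (`exists_sub_mem_maximalIdeal_of_coeff`); read in a field through injective maps with nested ranges this is
`EtaleLift.IsResiduallyRational` (`isResiduallyRational_range_of_coeff`). Nothing here is a statement of H. Hironaka's manuscript [Hironaka2017].
AI-written; AI review is weaker than expert review. [cite: StacksProject, Tag 00TV]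
-/

set_option linter.dupNamespace false

noncomputable section

namespace Summit.ResolutionOfSingularities.ResolutionOfSingularities.Theorems.SwitchingDichotomy.EtaleLift

open IsLocalRing Polynomial

/-- **Congruence of all elements from congruence of the generators.** `A = S[X]/(Q)`, `ι : A₀ → A` a ring map, `𝔫` an ideal of `A`: if each `of c`
(`c ∈ S`) and the root are congruent modulo `𝔫` to elements of `ι(A₀)`, then so is every element of `A`. [folklore] -/
theorem exists_sub_mem_of_coeff {S A₀ : Type} [CommRing S] [CommRing A₀] (Q : S[X]) (ι : A₀ →+* AdjoinRoot Q) (𝔫 : Ideal (AdjoinRoot Q))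
    (hcoeff : ∀ c : S, ∃ a₀ : A₀, AdjoinRoot.of Q c - ι a₀ ∈ 𝔫) (hroot : ∃ a₀ : A₀, AdjoinRoot.root Q - ι a₀ ∈ 𝔫) (a : AdjoinRoot Q) :
    ∃ a₀ : A₀, a - ι a₀ ∈ 𝔫 := by
  obtain ⟨q, rfl⟩ := AdjoinRoot.mk_surjective a
  induction q using Polynomial.induction_on with
  | C c =>
    rw [AdjoinRoot.mk_C]
    exact hcoeff c
  | add q₁ q₂ h₁ h₂ =>
    obtain ⟨a₁, ha₁⟩ := h₁
    obtain ⟨a₂, ha₂⟩ := h₂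
    refine ⟨a₁ + a₂, ?_⟩
    have : AdjoinRoot.mk Q (q₁ + q₂) - ι (a₁ + a₂) = (AdjoinRoot.mk Q q₁ - ι a₁) + (AdjoinRoot.mk Q q₂ - ι a₂) := by
      rw [map_add, map_add]; ring
    rw [this]
    exact 𝔫.add_mem ha₁ ha₂
  | monomial n c ih =>
    obtain ⟨a₁, ha₁⟩ := ih
    obtain ⟨a₂, ha₂⟩ := hroot
    refine ⟨a₁ * a₂, ?_⟩
    have : AdjoinRoot.mk Q (C c * X ^ (n + 1)) - ι (a₁ * a₂) =
        AdjoinRoot.mk Q (C c * X ^ n) * (AdjoinRoot.root Q - ι a₂) + (AdjoinRoot.mk Q (C c * X ^ n) - ι a₁) * ι a₂ := by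
      rw [pow_succ, ← mul_assoc, map_mul (AdjoinRoot.mk Q), AdjoinRoot.mk_X, map_mul (AdjoinRoot.mk Q), map_mul ι]; ring
    rw [this]
    exact 𝔫.add_mem (𝔫.mul_mem_left _ ha₂) (𝔫.mul_mem_right _ ha₁)

/-- The same read in `T := A_𝔫` (`𝔫` maximal): every `t ∈ T` is congruent modulo `𝔪_T` to the image of an element of `A₀`. [folklore] -/
theorem exists_sub_mem_maximalIdeal_of_coeff {S A₀ : Type} [CommRing S] [CommRing A₀] (Q : S[X]) (ι : A₀ →+* AdjoinRoot Q)
    (𝔫 : Ideal (AdjoinRoot Q)) [𝔫.IsMaximal]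
    (hcoeff : ∀ c : S, ∃ a₀ : A₀, AdjoinRoot.of Q c - ι a₀ ∈ 𝔫) (hroot : ∃ a₀ : A₀, AdjoinRoot.root Q - ι a₀ ∈ 𝔫)
    (t : Localization.AtPrime 𝔫) :
    ∃ a₀ : A₀, t - algebraMap (AdjoinRoot Q) (Localization.AtPrime 𝔫) (ι a₀) ∈ maximalIdeal (Localization.AtPrime 𝔫) := by
  -- `residue t = residue (algebraMap a)` for some `a ∈ A`
  obtain ⟨⟨a, s⟩, rfl⟩ := IsLocalization.mk'_surjective 𝔫.primeCompl t
  dsimp only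
  have hs : (s : AdjoinRoot Q) ∉ 𝔫 := s.2
  obtain ⟨s', hs'⟩ : ∃ s' : AdjoinRoot Q, (s : AdjoinRoot Q) * s' - 1 ∈ 𝔫 := by
    have hne : Ideal.Quotient.mk 𝔫 (s : AdjoinRoot Q) ≠ 0 := by rwa [Ne, Ideal.Quotient.eq_zero_iff_mem]
    letI := Ideal.Quotient.field 𝔫
    obtain ⟨c', hc'⟩ := (isUnit_iff_ne_zero.mpr hne).exists_right_inv
    obtain ⟨s', rfl⟩ := Ideal.Quotient.mk_surjective c'
    exact ⟨s', by rw [← Ideal.Quotient.eq_zero_iff_mem, map_sub, map_one, map_mul, hc', sub_self]⟩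
  obtain ⟨a₀, ha₀⟩ := exists_sub_mem_of_coeff Q ι 𝔫 hcoeff hroot (a * s')
  refine ⟨a₀, ?_⟩
  -- `mk' a s - alg (ι a₀) = (mk' a s - alg (a s')) + (alg (a s') - alg (ι a₀))`
  have h1 : IsLocalization.mk' (Localization.AtPrime 𝔫) a s - algebraMap _ (Localization.AtPrime 𝔫) (a * s') ∈
      maximalIdeal (Localization.AtPrime 𝔫) := by
    have hmk : IsLocalization.mk' (Localization.AtPrime 𝔫) a s - algebraMap (AdjoinRoot Q) (Localization.AtPrime 𝔫) (a * s') =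
        IsLocalization.mk' (Localization.AtPrime 𝔫) (a * (1 - (s : AdjoinRoot Q) * s')) s := by
      rw [eq_comm, IsLocalization.mk'_eq_iff_eq_mul, sub_mul, IsLocalization.mk'_spec, ← map_mul, ← map_sub]
      congr 1
      ring
    rw [hmk, IsLocalization.mk'_eq_mul_mk'_one, ← Localization.AtPrime.map_eq_maximalIdeal]
    refine Ideal.mul_mem_right _ _ (Ideal.mem_map_of_mem _ (Ideal.mul_mem_left _ _ ?_))
    have : (1 : AdjoinRoot Q) - (s : AdjoinRoot Q) * s' = -((s : AdjoinRoot Q) * s' - 1) := by ring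
    rw [this]
    exact 𝔫.neg_mem hs'
  have h2 : algebraMap _ (Localization.AtPrime 𝔫) (a * s') - algebraMap _ (Localization.AtPrime 𝔫) (ι a₀) ∈
      maximalIdeal (Localization.AtPrime 𝔫) := by
    rw [← map_sub, ← Localization.AtPrime.map_eq_maximalIdeal]
    exact Ideal.mem_map_of_mem _ ha₀
  have : IsLocalization.mk' (Localization.AtPrime 𝔫) a s - algebraMap _ (Localization.AtPrime 𝔫) (ι a₀) =
      (IsLocalization.mk' (Localization.AtPrime 𝔫) a s - algebraMap _ (Localization.AtPrime 𝔫) (a * s')) +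
        (algebraMap _ (Localization.AtPrime 𝔫) (a * s') - algebraMap _ (Localization.AtPrime 𝔫) (ι a₀)) := by ring
  rw [this]
  exact Ideal.add_mem _ h1 h2

/-- **Residual rationality of nested ranges.** `T₀ → T` a ring map `g` of local rings, `j : T → L′` injective into a field, `j₀ := j ∘ g`: if every `t ∈ T` is
congruent modulo `𝔪_T` to some `g t₀`, then `range j₀ ≤ range j` is residually rational (`EtaleLift.IsResiduallyRational`). [folklore] -/
theorem isResiduallyRational_range {T₀ T L' : Type} [CommRing T₀] [CommRing T] [IsLocalRing T₀] [IsLocalRing T] [Field L']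
    (g : T₀ →+* T) (j : T →+* L') (hj : Function.Injective j)
    (hrat : ∀ t : T, ∃ t₀ : T₀, t - g t₀ ∈ maximalIdeal T)
    (hle : (j.comp g).range ≤ j.range) [IsLocalRing (j.comp g).range] [IsLocalRing j.range] :
    IsResiduallyRational (j.comp g).range j.range hle := by
  intro z
  obtain ⟨t, ht⟩ : ∃ t : T, j t = (z : L') := z.2
  obtain ⟨t₀, ht₀⟩ := hrat t
  refine ⟨⟨j (g t₀), ⟨t₀, rfl⟩⟩, ?_⟩
  -- `z - j (g t₀) = j (t - g t₀)`, the image of a non-unit under the surjection `T → j.range`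
  have hsurj : Function.Surjective j.rangeRestrict := j.rangeRestrict_surjective
  have hbij : Function.Bijective j.rangeRestrict := ⟨fun _ _ h => hj (congrArg Subtype.val h), hsurj⟩
  have heq : z - Subring.inclusion hle ⟨j (g t₀), ⟨t₀, rfl⟩⟩ = j.rangeRestrict (t - g t₀) := by
    apply Subtype.ext
    change (z : L') - j (g t₀) = j (t - g t₀)
    rw [map_sub, ht]
  rw [heq]
  have hmax := map_maximalIdeal_of_surjective j.rangeRestrict hsurj
  rw [← hmax]
  exact Ideal.mem_map_of_mem _ ht₀

end Summit.ResolutionOfSingularities.ResolutionOfSingularities.Theorems.SwitchingDichotomy.EtaleLift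

end
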